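import Summits.MatrixMultiplication.OmegaCensus.SmallFormats.MatMul22nCheapSpansCol
import HarnessLib

/-!
# ω-census family (a): the STRUCTURE THEOREM of a 4-loaded rank-one plane at length `3n + 3` (any field, `n ≥ 8`) — one statement per plane

Cell `pub-omega` (unit `pub-omega-tensor`, gen 39), topic `Summits/MatrixMultiplication/OmegaCensus` (sub-folder
`SmallFormats`). Framing (verbatim): lottery ticket; floor = certified bounds/negative ranges. HONEST FRAMING: packaging — the kernel
laws p728768 (cheap functionals) and p729281 / p731118 (cheap spans) assembled into the single statement that tensor g39's instrument
(kitjob-all4sat, `LD` variants) imposes per loaded plane: for a ROW plane carrying exactly 4 X-forms there are two linearly independent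
output columns `c 0, c 1` that (i) are cheap (`∑_i c_m(i) (ν ᵥ* W_t)_i = 0` off the plane) and (ii) contain every Y-form row of the plane's
4 terms; dually for a COLUMN plane (input vectors `b 0, b 1`, `g_t(ν bᵀ) = 0` off the plane, output rows inside `span(b 0, b 1)`). Any field;
structural; nothing on `ω`. In the all-4 world of LAW-3M3-g38 §6 this is the «normal form» of every one of the eight planes, now kernel.
-/

namespace Summit.MatrixMultiplication.OmegaCensus.SmallFormats

open Finset Module Matrix
open Literature.Computability.AlgebraicComplexity
open Summit.MatrixMultiplication.OmegaCensus.RankOnePlaneCapGeneral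

namespace CheapSpans

variable {k : Type*} [Field k] {n : ℕ} {ι : Type*} [Fintype ι]

omit [Fintype ι] in
/-- Two linearly independent members of a submodule of `finrank ≥ 2`, in coefficient form. -/
theorem exists_indepPair_of_two_le_finrank (C : Submodule k (Fin n → k)) (h2 : 2 ≤ finrank k C) :
    ∃ c : Fin 2 → (Fin n → k), (∀ m, c m ∈ C) ∧ ∀ a : Fin 2 → k, ∑ m, a m • c m = 0 → ∀ m, a m = 0 := by
  classical
  let bC := Module.finBasis k C
  have h0 : 0 < finrank k C := by omega
  have h1 : 1 < finrank k C := by omega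
  let f : Fin 2 → Fin (finrank k C) := fun m => if m = 0 then ⟨0, h0⟩ else ⟨1, h1⟩
  have hf : Function.Injective f := by
    intro x y hxy
    have hv : (f x).val = (f y).val := by rw [hxy]
    fin_cases x <;> fin_cases y
    · rfl
    · exact absurd hv (by simp [f])
    · exact absurd hv (by simp [f])
    · rfl
  have hli : LinearIndependent k (fun m => (bC (f m) : Fin n → k)) := by
    have h := (bC.linearIndependent.comp f hf).map' C.subtype (Submodule.ker_subtype C)
    exact h
  refine ⟨fun m => (bC (f m) : Fin n → k), fun m => (bC (f m)).2, ?_⟩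
  intro a ha
  exact fun m => (Fintype.linearIndependent_iff.mp hli a ha) m

omit [Fintype ι] in
/-- `ν = (−λ₁, λ₀)` is nonzero when `λ` is. -/
theorem nu_ne_zero (lam : Fin 2 → k) (hlam : lam ≠ 0) : (![-lam 1, lam 0] : Fin 2 → k) ≠ 0 := by
  intro h
  apply hlam
  have h0 := congrFun h 0
  have h1 := congrFun h 1
  simp at h0 h1
  funext j; fin_cases j <;> simp [h0, h1]

/-- **Structure of a 4-loaded ROW plane** (`⟨2,2,n⟩`, any field, `n ≥ 8`, length `≤ 3n+3`): two independent CHEAP output columns containing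
every Y-form row of the plane's four terms. -/
theorem loadedRowPlane_structure (hn : 8 ≤ n) (β : BilinComp (mulBilin k 2 2 n) ι) (hι : Fintype.card ι ≤ 3 * n + 3)
    (lam : Fin 2 → k) (hlam : lam ≠ 0) (S : Finset ι) (hS4 : S.card = 4)
    (hS : ∀ i ∈ S, Matrix.vecMul lam (xMarginal β i) = 0) :
    ∃ c : Fin 2 → (Fin n → k),
      (∀ a : Fin 2 → k, ∑ m, a m • c m = 0 → ∀ m, a m = 0) ∧
      (∀ t, t ∉ S → ∀ m, ∑ i, c m i * (Matrix.vecMul ![-lam 1, lam 0] (β.w t)) i = 0) ∧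
      (∀ s ∈ S, ∀ κ : Fin 2, ∃ a : Fin 2 → k, (fun j => β.g s (Matrix.single κ j (1 : k))) = ∑ m, a m • c m) := by
  obtain ⟨C, hcard, hC⟩ := CheapCensus.cheapFunctionals_rowPlane hn β hι lam hlam S hS
  obtain ⟨c, hcC, hind⟩ := exists_indepPair_of_two_le_finrank C (by omega)
  have hcheap : ∀ t, t ∉ S → ∀ m, ∑ i, c m i * (Matrix.vecMul ![-lam 1, lam 0] (β.w t)) i = 0 :=
    fun t ht m => hC (c m) (hcC m) t ht
  exact ⟨c, hind, hcheap, gRow_mem_span β _ (nu_ne_zero lam hlam) S (by omega) c hind hcheap⟩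

/-- **Structure of a 4-loaded COLUMN plane**: two independent CHEAP input vectors `b 0, b 1` (`g_t(ν (b m)ᵀ) = 0` off the plane) spanning every
output row of the plane's four terms. -/
theorem loadedColPlane_structure (hn : 8 ≤ n) (β : BilinComp (mulBilin k 2 2 n) ι) (hι : Fintype.card ι ≤ 3 * n + 3)
    (mu : Fin 2 → k) (hmu : mu ≠ 0) (S : Finset ι) (hS4 : S.card = 4)
    (hS : ∀ i ∈ S, Matrix.mulVec (xMarginal β i) mu = 0) :
    ∃ b : Fin 2 → (Fin n → k),
      (∀ a : Fin 2 → k, ∑ m, a m • b m = 0 → ∀ m, a m = 0) ∧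
      (∀ t, t ∉ S → ∀ m, β.g t (Matrix.vecMulVec ![-mu 1, mu 0] (b m)) = 0) ∧
      (∀ s ∈ S, ∀ κ : Fin 2, ∃ a : Fin 2 → k, β.w s κ = ∑ m, a m • b m) := by
  obtain ⟨B, hcard, hB⟩ := CheapCensus.cheapFunctionals_colPlane hn β hι mu hmu S hS
  obtain ⟨b, hbB, hind⟩ := exists_indepPair_of_two_le_finrank B (by omega)
  have hcheap : ∀ t, t ∉ S → ∀ m, β.g t (Matrix.vecMulVec ![-mu 1, mu 0] (b m)) = 0 :=
    fun t ht m => hB (b m) (hbB m) t ht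
  exact ⟨b, hind, hcheap, wRow_mem_span β _ (nu_ne_zero mu hmu) S (by omega) b hind hcheap⟩

end CheapSpans

end Summit.MatrixMultiplication.OmegaCensus.SmallFormats
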